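import Summits.CriticalPhenomena.PercolationContinuityZ3.Theorems.PercNearOneGluingNoHeavyLowerTailThreePartitionVOrderNested
import HarnessLib.Audit

/-!
# `NoHeavyLowerTail` (crux stmt-CriticalPhenomena-4575), master-family hierarchy P3 (gen 37): Q-PATTERNS — the product
# decomposition of twisted three-partition counts over `ι = Q ⊔ Qᶜ`, and the `Φ − R` form of the twisted functional

Support file (seat `prim-masterthm-p3`; `--supports stmt-CriticalPhenomena-4575`; memo
`run/shared/lean/prim/prim-masterthm/FROM-prim-masterthm-p3-g37-ONE-DISJUNCTION.md` §0, §2).  Toolkit for the ONE-DISJUNCTION theorem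
(`threePartNT τ (orFam Q) A B ≥ 0` for ALL up-sets `A, B`, files `…ThreePartitionOneOrBase`, `…ThreePartitionOneOr`).

PRODUCT DECOMPOSITION (this file).  An ordered 3-partition `(S₁,S₂,S₃)` of `ι` is the pair (its Q-PATTERN `(S₁∩Q, S₂∩Q, S₃∩Q)`, its
trace off `Q`); the copies `x_a = S_a ∆ τ` split accordingly as `x_a = (x_a \ Q) ∪ m_a` with the twisted Q-parts `m_a = (S_a ∩ Q) ∆ (τ ∩ Q)`
(`qc₁ qc₂ qc₃`).  Parking all of `Q` in the FIRST PART gives the representatives `{x : x₁ ∩ Q = Q \ τ}` of the traces, and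
**`triT_eq_sum_cfgsIn`**: `triT τ p = ∑_{P ∈ cfgsIn Q} #{x : x₁ ∩ Q = Q \ τ ∧ p ((x₁\Q) ∪ m₁ P) ((x₂\Q) ∪ m₂ P) ((x₃\Q) ∪ m₃ P)}` — every twisted
count is a sum over the `3^{|Q|}` patterns of counts of representatives, for EVERY twist `τ`.
THE `Φ − R` FORM (this file, any test family `𝒰`): `threePartNT τ 𝒰 A B = Φ − R` with the 'one-copy' part
`Φ = 2·#{x₃ ∈ 𝒰∩A∩B} − #{x₁ ∈ 𝒰, x₃ ∈ A∩B}` and the 'two-copy' part `R = #{x₂∈A, x₃∈B, x₃∈𝒰} + #{x₂∈A, x₃∈B, x₂∈𝒰} − #{x₂∈A, x₃∈B, x₁∈𝒰}`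
(`threePartNT_eq_phiPart_sub_rPart`; relabelling the parts, `triT_swap12/13/23`).
HONEST LABEL: bookkeeping identities; nothing here bears on the (closed) crux. [this work]
-/

noncomputable section

open Finset
open scoped symmDiff Classical

namespace Summit.CriticalPhenomena.PercolationContinuityZ3.Theorems.ThreePartition

variable {ι : Type*} [Fintype ι]

/-! ## Q-patterns -/

omit [Fintype ι] in
/-- The third part of a Q-pattern `P = (P₁, P₂)`: `Q \ (P₁ ∪ P₂)`. [this work] -/
def pt₃ (Q : Set ι) (P : Set ι × Set ι) : Set ι := Q \ (P.1 ∪ P.2)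

/-- The Q-PATTERNS: ordered 3-partitions `(P₁, P₂, P₃)` of the subset `Q`, encoded as disjoint pairs of subsets of `Q`. [this work] -/
def cfgsIn (Q : Set ι) : Finset (Set ι × Set ι) := univ.filter fun P => P.1 ⊆ Q ∧ P.2 ⊆ Q ∧ Disjoint P.1 P.2

/-- Membership in `cfgsIn Q`. [this work] -/
theorem mem_cfgsIn {Q : Set ι} {P : Set ι × Set ι} : P ∈ cfgsIn Q ↔ P.1 ⊆ Q ∧ P.2 ⊆ Q ∧ Disjoint P.1 P.2 := by
  unfold cfgsIn; simp only [mem_filter, mem_univ, true_and]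

omit [Fintype ι] in
/-- Twisted Q-part in copy 1: `P₁ ∆ (τ ∩ Q)`. [this work] -/
def qc₁ (τ Q : Set ι) (P : Set ι × Set ι) : Set ι := P.1 ∆ (τ ∩ Q)
omit [Fintype ι] in
/-- Twisted Q-part in copy 2: `P₂ ∆ (τ ∩ Q)`. [this work] -/
def qc₂ (τ Q : Set ι) (P : Set ι × Set ι) : Set ι := P.2 ∆ (τ ∩ Q)
omit [Fintype ι] in
/-- Twisted Q-part in copy 3: `P₃ ∆ (τ ∩ Q)`. [this work] -/
def qc₃ (τ Q : Set ι) (P : Set ι × Set ι) : Set ι := pt₃ Q P ∆ (τ ∩ Q)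

omit [Fintype ι] in
/-- Membership in `qc₁`. [this work] -/
theorem mem_qc₁_iff (τ Q : Set ι) (P : Set ι × Set ι) (c : ι) : c ∈ qc₁ τ Q P ↔ (c ∈ P.1 ∧ ¬ (c ∈ τ ∧ c ∈ Q) ∨ (c ∈ τ ∧ c ∈ Q) ∧ c ∉ P.1) := by
  unfold qc₁; rw [Set.mem_symmDiff, Set.mem_inter_iff]
omit [Fintype ι] in
/-- Membership in `qc₂`. [this work] -/
theorem mem_qc₂_iff (τ Q : Set ι) (P : Set ι × Set ι) (c : ι) : c ∈ qc₂ τ Q P ↔ (c ∈ P.2 ∧ ¬ (c ∈ τ ∧ c ∈ Q) ∨ (c ∈ τ ∧ c ∈ Q) ∧ c ∉ P.2) := by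
  unfold qc₂; rw [Set.mem_symmDiff, Set.mem_inter_iff]
omit [Fintype ι] in
/-- Membership in `qc₃`. [this work] -/
theorem mem_qc₃_iff (τ Q : Set ι) (P : Set ι × Set ι) (c : ι) :
    c ∈ qc₃ τ Q P ↔ ((c ∈ Q ∧ ¬ (c ∈ P.1 ∨ c ∈ P.2)) ∧ ¬ (c ∈ τ ∧ c ∈ Q) ∨ (c ∈ τ ∧ c ∈ Q) ∧ ¬ (c ∈ Q ∧ ¬ (c ∈ P.1 ∨ c ∈ P.2))) := by
  unfold qc₃ pt₃; rw [Set.mem_symmDiff, Set.mem_inter_iff, Set.mem_sdiff, Set.mem_union]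

omit [Fintype ι] in
/-- The twisted Q-parts lie inside `Q`. [this work] -/
theorem qc₁_subset {τ Q : Set ι} {P : Set ι × Set ι} (hP : P.1 ⊆ Q) : qc₁ τ Q P ⊆ Q := by
  intro c hc; rw [mem_qc₁_iff] at hc
  rcases hc with ⟨h1, _⟩ | ⟨⟨_, hQ⟩, _⟩
  · exact hP h1
  · exact hQ
omit [Fintype ι] in
/-- The twisted Q-parts lie inside `Q`. [this work] -/
theorem qc₂_subset {τ Q : Set ι} {P : Set ι × Set ι} (hP : P.2 ⊆ Q) : qc₂ τ Q P ⊆ Q := by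
  intro c hc; rw [mem_qc₂_iff] at hc
  rcases hc with ⟨h1, _⟩ | ⟨⟨_, hQ⟩, _⟩
  · exact hP h1
  · exact hQ
omit [Fintype ι] in
/-- The twisted Q-parts lie inside `Q`. [this work] -/
theorem qc₃_subset (τ Q : Set ι) (P : Set ι × Set ι) : qc₃ τ Q P ⊆ Q := by
  intro c hc; rw [mem_qc₃_iff] at hc
  rcases hc with ⟨⟨hQ, _⟩, _⟩ | ⟨⟨_, hQ⟩, _⟩
  · exact hQ
  · exact hQ

/-! ## The product decomposition of twisted counts -/

omit [Fintype ι] in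
/-- A copy splits into its trace off `Q` and its (twisted) Q-part: `S ∆ τ = ((S ∆ τ) \ Q) ∪ ((S ∩ Q) ∆ (τ ∩ Q))`. [folklore] -/
theorem symmDiff_eq_sdiff_union_inter (S τ Q : Set ι) : S ∆ τ = (S ∆ τ) \ Q ∪ (S ∩ Q) ∆ (τ ∩ Q) := by
  ext c
  simp only [Set.mem_union, Set.mem_sdiff, Set.mem_symmDiff, Set.mem_inter_iff]
  tauto

omit [Fintype ι] in
/-- The trace of a copy off `Q` only depends on the trace of the part off `Q`. [folklore] -/
theorem symmDiff_sdiff_eq_of_sdiff_eq {S S' Q : Set ι} (τ : Set ι) (h : S \ Q = S' \ Q) : (S ∆ τ) \ Q = (S' ∆ τ) \ Q := by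
  ext c
  have key : c ∈ S \ Q ↔ c ∈ S' \ Q := by rw [h]
  simp only [Set.mem_sdiff] at key
  simp only [Set.mem_sdiff, Set.mem_symmDiff]
  by_cases hcQ : c ∈ Q
  · simp only [hcQ, not_true, and_false]
  · simp only [hcQ, not_false_iff, and_true] at key ⊢
    rw [key]

omit [Fintype ι] in
/-- Parking `Q` in part 1 does not change part 1 off `Q`. [folklore] -/
theorem union_sdiff_self_eq (S Q : Set ι) : (S ∪ Q) \ Q = S \ Q := by
  ext c; simp only [Set.mem_sdiff, Set.mem_union]; tauto

omit [Fintype ι] in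
/-- Removing `Q` from part 2 does not change part 2 off `Q`. [folklore] -/
theorem sdiff_sdiff_self_eq (S Q : Set ι) : (S \ Q) \ Q = S \ Q := by
  ext c; simp only [Set.mem_sdiff]; tauto

omit [Fintype ι] in
/-- … nor part 3 off `Q`. [folklore] -/
theorem compl_park_sdiff_eq (S₁ S₂ Q : Set ι) : (S₁ ∪ Q ∪ S₂ \ Q)ᶜ \ Q = (S₁ ∪ S₂)ᶜ \ Q := by
  ext c; simp only [Set.mem_sdiff, Set.mem_compl_iff, Set.mem_union]; tauto

omit [Fintype ι] in
/-- Putting the pattern back does not change part 1 off `Q`. [folklore] -/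
theorem sdiff_union_sdiff_eq {S m Q : Set ι} (hm : m ⊆ Q) : (S \ Q ∪ m) \ Q = S \ Q := by
  ext c; simp only [Set.mem_sdiff, Set.mem_union]
  constructor
  · rintro ⟨h | h, hQ⟩
    · exact ⟨h.1, hQ⟩
    · exact absurd (hm h) hQ
  · rintro ⟨h, hQ⟩; exact ⟨Or.inl ⟨h, hQ⟩, hQ⟩

omit [Fintype ι] in
/-- Putting the pattern back does not change part 2 off `Q`. [folklore] -/
theorem union_sdiff_eq_of_subset {S m Q : Set ι} (hm : m ⊆ Q) : (S ∪ m) \ Q = S \ Q := by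
  ext c; simp only [Set.mem_sdiff, Set.mem_union]
  constructor
  · rintro ⟨h | h, hQ⟩
    · exact ⟨h, hQ⟩
    · exact absurd (hm h) hQ
  · rintro ⟨h, hQ⟩; exact ⟨Or.inl h, hQ⟩

omit [Fintype ι] in
/-- … nor part 3 off `Q`. [folklore] -/
theorem compl_unpark_sdiff_eq {S₁ S₂ m₁ m₂ Q : Set ι} (h₁ : m₁ ⊆ Q) (h₂ : m₂ ⊆ Q) :
    (S₁ \ Q ∪ m₁ ∪ (S₂ ∪ m₂))ᶜ \ Q = (S₁ ∪ S₂)ᶜ \ Q := by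
  ext c; simp only [Set.mem_sdiff, Set.mem_compl_iff, Set.mem_union]
  have i1 : c ∈ m₁ → c ∈ Q := fun h => h₁ h
  have i2 : c ∈ m₂ → c ∈ Q := fun h => h₂ h
  tauto

/-- **Product decomposition of a twisted 3-partition count over `ι = Q ⊔ Qᶜ`** (any twist): group the configurations by their
Q-pattern `P = (S₁∩Q, S₂∩Q)` and represent each class by parking `Q` in the first part; the copies of the original configuration are
`(x_a \ Q) ∪ qc_a τ Q P` in terms of the copies `x_a` of the representative, and the representatives are exactly the configurations
with `x₁ ∩ Q = Q \ τ`. [this work] -/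
theorem triT_eq_sum_cfgsIn (τ Q : Set ι) (p : Set ι → Set ι → Set ι → Prop) :
    triT τ p = ∑ P ∈ cfgsIn Q, triT τ (fun x₁ x₂ x₃ => x₁ ∩ Q = Q \ τ ∧
      p (x₁ \ Q ∪ qc₁ τ Q P) (x₂ \ Q ∪ qc₂ τ Q P) (x₃ \ Q ∪ qc₃ τ Q P)) := by
  unfold triT tri
  -- group by the Q-pattern
  have hmaps : ∀ q ∈ (univ.filter fun q : Set ι × Set ι => Disjoint q.1 q.2 ∧ p (q.1 ∆ τ) (q.2 ∆ τ) ((q.1 ∪ q.2)ᶜ ∆ τ)),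
      (fun q : Set ι × Set ι => (q.1 ∩ Q, q.2 ∩ Q)) q ∈ cfgsIn Q := by
    intro q hq
    simp only [mem_filter, mem_univ, true_and] at hq
    rw [mem_cfgsIn]
    exact ⟨Set.inter_subset_right, Set.inter_subset_right,
      Disjoint.mono Set.inter_subset_left Set.inter_subset_left hq.1⟩
  rw [card_eq_sum_card_fiberwise hmaps]
  refine sum_congr rfl fun P hP => ?_
  rw [mem_cfgsIn] at hP
  obtain ⟨hP1, hP2, hPd⟩ := hP
  have hP3 : pt₃ Q P ⊆ Q := fun c hc => hc.1
  -- representatives contain `Q` in part 1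
  have rep : ∀ q : Set ι × Set ι, Disjoint q.1 q.2 → q.1 ∆ τ ∩ Q = Q \ τ → (∀ c, c ∈ Q → c ∈ q.1) ∧ (∀ c, c ∈ Q → c ∉ q.2) := by
    intro q hd hrep
    have hQ1 : ∀ c, c ∈ Q → c ∈ q.1 := by
      intro c hc
      have key : c ∈ q.1 ∆ τ ∩ Q ↔ c ∈ Q \ τ := by rw [hrep]
      simp only [Set.mem_inter_iff, Set.mem_symmDiff, Set.mem_sdiff] at key
      by_cases hct : c ∈ τ
      · by_contra h1
        exact (key.1 ⟨Or.inr ⟨hct, h1⟩, hc⟩).2 hct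
      · exact ((key.2 ⟨hc, hct⟩).1.resolve_right (fun h => hct h.1)).1
    exact ⟨hQ1, fun c hc h2 => Set.disjoint_left.1 hd (hQ1 c hc) h2⟩
  refine card_bij' (fun q _ => (q.1 ∪ Q, q.2 \ Q)) (fun q _ => (q.1 \ Q ∪ P.1, q.2 ∪ P.2)) ?_ ?_ ?_ ?_
  · -- forward map lands in the representatives and the predicate is transported
    intro q hq
    simp only [mem_filter, mem_univ, true_and] at hq ⊢
    obtain ⟨⟨hd, hp⟩, hpat⟩ := hq
    have e1 : q.1 ∩ Q = P.1 := (Prod.mk.inj hpat).1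
    have e2 : q.2 ∩ Q = P.2 := (Prod.mk.inj hpat).2
    have hd' : ∀ c, c ∈ q.1 → c ∈ q.2 → False := fun c h1 h2 => Set.disjoint_left.1 hd h1 h2
    refine ⟨?_, ?_, ?_⟩
    · refine Set.disjoint_left.2 fun c h1 h2 => ?_
      rw [Set.mem_sdiff] at h2
      rcases h1 with h1 | h1
      · exact hd' c h1 h2.1
      · exact h2.2 h1
    · ext c
      simp only [Set.mem_inter_iff, Set.mem_symmDiff, Set.mem_union, Set.mem_sdiff]
      tauto
    · have k1 : (q.1 ∪ Q) ∆ τ \ Q ∪ qc₁ τ Q P = q.1 ∆ τ := by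
        unfold qc₁
        rw [symmDiff_sdiff_eq_of_sdiff_eq τ (union_sdiff_self_eq q.1 Q), ← e1]
        exact (symmDiff_eq_sdiff_union_inter q.1 τ Q).symm
      have k2 : (q.2 \ Q) ∆ τ \ Q ∪ qc₂ τ Q P = q.2 ∆ τ := by
        unfold qc₂
        rw [symmDiff_sdiff_eq_of_sdiff_eq τ (sdiff_sdiff_self_eq q.2 Q), ← e2]
        exact (symmDiff_eq_sdiff_union_inter q.2 τ Q).symm
      have e3 : (q.1 ∪ q.2)ᶜ ∩ Q = pt₃ Q P := by
        unfold pt₃; rw [← e1, ← e2]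
        ext c; simp only [Set.mem_inter_iff, Set.mem_compl_iff, Set.mem_union, Set.mem_sdiff]; tauto
      have k3 : (q.1 ∪ Q ∪ q.2 \ Q)ᶜ ∆ τ \ Q ∪ qc₃ τ Q P = (q.1 ∪ q.2)ᶜ ∆ τ := by
        unfold qc₃
        rw [symmDiff_sdiff_eq_of_sdiff_eq τ (compl_park_sdiff_eq q.1 q.2 Q), ← e3]
        exact (symmDiff_eq_sdiff_union_inter (q.1 ∪ q.2)ᶜ τ Q).symm
      rw [k1, k2, k3]
      exact hp
  · -- backward map lands in the fibre
    intro q hq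
    simp only [mem_filter, mem_univ, true_and] at hq ⊢
    obtain ⟨hd, hrep, hp⟩ := hq
    obtain ⟨hQ1, hQ2⟩ := rep q hd hrep
    have hd' : ∀ c, c ∈ q.1 → c ∈ q.2 → False := fun c h1 h2 => Set.disjoint_left.1 hd h1 h2
    have hPd' : ∀ c, c ∈ P.1 → c ∈ P.2 → False := fun c h1 h2 => Set.disjoint_left.1 hPd h1 h2
    have f1 : (q.1 \ Q ∪ P.1) ∩ Q = P.1 := by
      ext c; simp only [Set.mem_inter_iff, Set.mem_union, Set.mem_sdiff]
      have i1 : c ∈ P.1 → c ∈ Q := fun h => hP1 h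
      tauto
    have f2 : (q.2 ∪ P.2) ∩ Q = P.2 := by
      ext c; simp only [Set.mem_inter_iff, Set.mem_union]
      have i1 := hQ2 c
      have i2 : c ∈ P.2 → c ∈ Q := fun h => hP2 h
      tauto
    refine ⟨⟨?_, ?_⟩, Prod.ext f1 f2⟩
    · refine Set.disjoint_left.2 fun c h1 h2 => ?_
      rcases h1 with h1 | h1 <;> rcases h2 with h2 | h2
      · exact hd' c h1.1 h2
      · exact h1.2 (hP2 h2)
      · exact hQ2 c (hP1 h1) h2
      · exact hPd' c h1 h2
    · have k1 : (q.1 \ Q ∪ P.1) ∆ τ = q.1 ∆ τ \ Q ∪ qc₁ τ Q P := by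
        unfold qc₁
        rw [symmDiff_eq_sdiff_union_inter (q.1 \ Q ∪ P.1) τ Q, f1, symmDiff_sdiff_eq_of_sdiff_eq τ (sdiff_union_sdiff_eq hP1)]
      have k2 : (q.2 ∪ P.2) ∆ τ = q.2 ∆ τ \ Q ∪ qc₂ τ Q P := by
        unfold qc₂
        rw [symmDiff_eq_sdiff_union_inter (q.2 ∪ P.2) τ Q, f2, symmDiff_sdiff_eq_of_sdiff_eq τ (union_sdiff_eq_of_subset hP2)]
      have f3 : (q.1 \ Q ∪ P.1 ∪ (q.2 ∪ P.2))ᶜ ∩ Q = pt₃ Q P := by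
        unfold pt₃
        ext c; simp only [Set.mem_inter_iff, Set.mem_compl_iff, Set.mem_union, Set.mem_sdiff]
        have := hQ1 c; tauto
      have k3 : (q.1 \ Q ∪ P.1 ∪ (q.2 ∪ P.2))ᶜ ∆ τ = (q.1 ∪ q.2)ᶜ ∆ τ \ Q ∪ qc₃ τ Q P := by
        unfold qc₃
        rw [symmDiff_eq_sdiff_union_inter (q.1 \ Q ∪ P.1 ∪ (q.2 ∪ P.2))ᶜ τ Q, f3,
          symmDiff_sdiff_eq_of_sdiff_eq τ (compl_unpark_sdiff_eq hP1 hP2)]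
      rw [k1, k2, k3]
      exact hp
  · -- left inverse
    intro q hq
    simp only [mem_filter, mem_univ, true_and] at hq
    obtain ⟨⟨hd, _⟩, hpat⟩ := hq
    have e1 : q.1 ∩ Q = P.1 := (Prod.mk.inj hpat).1
    have e2 : q.2 ∩ Q = P.2 := (Prod.mk.inj hpat).2
    refine Prod.ext ?_ ?_
    · show (q.1 ∪ Q) \ Q ∪ P.1 = q.1
      rw [← e1]; ext c
      simp only [Set.mem_union, Set.mem_sdiff, Set.mem_inter_iff]; tauto
    · show q.2 \ Q ∪ P.2 = q.2
      rw [← e2]; ext c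
      simp only [Set.mem_union, Set.mem_sdiff, Set.mem_inter_iff]; tauto
  · -- right inverse
    intro q hq
    simp only [mem_filter, mem_univ, true_and] at hq
    obtain ⟨hd, hrep, _⟩ := hq
    obtain ⟨hQ1, hQ2⟩ := rep q hd hrep
    refine Prod.ext ?_ ?_
    · show q.1 \ Q ∪ P.1 ∪ Q = q.1
      ext c; simp only [Set.mem_union, Set.mem_sdiff]
      have i1 := hQ1 c
      have i2 : c ∈ P.1 → c ∈ Q := fun h => hP1 h
      tauto
    · show (q.2 ∪ P.2) \ Q = q.2
      ext c; simp only [Set.mem_union, Set.mem_sdiff]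
      have i1 := hQ2 c
      have i2 : c ∈ P.2 → c ∈ Q := fun h => hP2 h
      tauto

/-! ## The `Φ − R` form of the twisted functional (any test family `𝒰`) -/

/-- The ONE-COPY part `Φ = 2·#{x₃ ∈ 𝒰 ∩ A ∩ B} − #{x₁ ∈ 𝒰, x₃ ∈ A ∩ B}` (units `a`, `b` minus the `N3` tokens, all read on
copy 3). [this work] -/
def phiPart (τ : Set ι) (𝒰 A B : Set (Set ι)) : ℤ :=
  2 * (triT τ (fun _ _ x₃ => x₃ ∈ 𝒰 ∧ x₃ ∈ A ∧ x₃ ∈ B) : ℤ) - triT τ (fun x₁ _ x₃ => x₁ ∈ 𝒰 ∧ x₃ ∈ A ∧ x₃ ∈ B)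

/-- The TWO-COPY part `R = #{x₂∈A, x₃∈B, x₃∈𝒰} + #{x₂∈A, x₃∈B, x₂∈𝒰} − #{x₂∈A, x₃∈B, x₁∈𝒰}` (the `N1` and `N2` tokens minus
the `T` tokens, all read with `A` on copy 2 and `B` on copy 3). [this work] -/
def rPart (τ : Set ι) (𝒰 A B : Set (Set ι)) : ℤ :=
  (triT τ (fun _ x₂ x₃ => x₂ ∈ A ∧ x₃ ∈ B ∧ x₃ ∈ 𝒰) : ℤ) + triT τ (fun _ x₂ x₃ => x₂ ∈ A ∧ x₃ ∈ B ∧ x₂ ∈ 𝒰)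
    - triT τ (fun x₁ x₂ x₃ => x₂ ∈ A ∧ x₃ ∈ B ∧ x₁ ∈ 𝒰)

/-- **`threePartNT τ 𝒰 A B = Φ − R`** (relabelling the parts). [this work] -/
theorem threePartNT_eq_phiPart_sub_rPart (τ : Set ι) (𝒰 A B : Set (Set ι)) :
    threePartNT τ 𝒰 A B = phiPart τ 𝒰 A B - rPart τ 𝒰 A B := by
  have h1 : topT τ (𝒰 ∩ A ∩ B) = triT τ (fun _ _ x₃ => x₃ ∈ 𝒰 ∧ x₃ ∈ A ∧ x₃ ∈ B) := by
    unfold topT; refine triT_congr fun a b c => ?_; simp only [Set.mem_inter_iff, and_assoc]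
  have h2 : deeT τ 𝒰 (A ∩ B) = triT τ (fun x₁ _ x₃ => x₁ ∈ 𝒰 ∧ x₃ ∈ A ∧ x₃ ∈ B) := by
    unfold deeT; refine triT_congr fun a b c => ?_; simp only [Set.mem_inter_iff]
  have h3 : deeT τ A (𝒰 ∩ B) = triT τ (fun _ x₂ x₃ => x₂ ∈ A ∧ x₃ ∈ B ∧ x₃ ∈ 𝒰) := by
    unfold deeT; rw [triT_swap12]; refine triT_congr fun a b c => ?_; simp only [Set.mem_inter_iff]; tauto
  have h4 : deeT τ B (𝒰 ∩ A) = triT τ (fun _ x₂ x₃ => x₂ ∈ A ∧ x₃ ∈ B ∧ x₂ ∈ 𝒰) := by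
    unfold deeT; rw [triT_swap13, triT_swap12]; refine triT_congr fun a b c => ?_; simp only [Set.mem_inter_iff]; tauto
  have h5 : teeT τ 𝒰 A B = triT τ (fun x₁ x₂ x₃ => x₂ ∈ A ∧ x₃ ∈ B ∧ x₁ ∈ 𝒰) := by
    unfold teeT; refine triT_congr fun a b c => ?_; tauto
  unfold threePartNT phiPart rPart
  rw [h1, h2, h3, h4, h5]
  push_cast
  ring

end Summit.CriticalPhenomena.PercolationContinuityZ3.Theorems.ThreePartition

end
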